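import Summits.BirchSwinnertonDyer.Rank1Residual.Additive.RamifiedSevenGenusKatoExpFrame
import Summits.BirchSwinnertonDyer.Rank1Residual.Additive.RamifiedSevenRationalComparisonAlgebra
import Literature.NumberTheory.EllipticCurves.IwasawaAlgebraCharacterEvaluationCongruence
import HarnessLib

set_option autoImplicit false

/-!
# `𝒞₇` genus road (crux `EllipticUnitValueSevenOfGZK`, K7r), REPAIR ROW (C6-R): THE RE-TYPED DUAL-EXPONENTIAL VALUE DATUM
# `KatoExpDatum hγ Φ` of a pinned frame — successor of `DualExpValueDatum hγ Φ` (`RamifiedSevenGenusKatoExpFrame`, p781874),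
# whose Skolemised Artin field `art` is UN-INHABITABLE; with the `Prop` `KatoExpCompatShape`, the DERIVED interface
# «`σ_𝔟 = (1+X)^{κ(𝔟)} ∈ Λ` acts on `χ`-values by `χ(𝔟)⁻¹`» (a theorem, not a field), the re-issued API and the explicit
# data `xTilde / cZ / normA / jα / wα` of block (R); a structure, a predicate and definitions with bodies — NOTHING asserted,
# NO named fact

Cell bsd-cm, seat bsd-cm-prr-ty1 g34 (literature-prover), REPAIR ROW (C6-R) minted by the pen bsd-cm-plan g37 (rulings
D1008 (vacuity confirmed) / D1009 (design (T-a) data + (T-c) interface) / D1011 ((a′) any natural lift; (b) finite-level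
hypotheses; order)), after this seat's memo `pub/bsd-cm/bsd-cm-prr-ty1/g34/DualExpValueDatum-scope.md` (11bd8f635d040652).
Imports: (E) `RamifiedSevenGenusKatoExpFrame` (the frame-level API `ιC_sqrtNegSeven_sq`, `piK_smul`, `piK_piK`,
`inv_chi_γK_pow_eq_one`, and the datum-FREE shapes `TwoSidedComparisonShape` / `PeriodScaledComparisonShape`, all REUSED),
(A) `RamifiedSevenRationalComparisonAlgebra` (`two_mul_natCast_eq_unit_mul_pow`, for `isUnit_wα`), (L) the Literature
module `IwasawaAlgebraCharacterEvaluationCongruence` (`val_binomialSeries_smul`: a `p`-adic power `(1+X)^x` acts on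
level-`N` values by `u^m`, `m ≡ x (mod p^N)`).

## ERRATUM for `DualExpValueDatum` (pen D1008; this seat's finding, STATUS 2026-08-31 l.3958–3962)

The field `DualExpValueDatum.art` asks for ONE natural number `artExp 𝔟 : ℕ` with `χ(𝔟) = χ(γK)^{artExp 𝔟}` for EVERY
character `χ` of EVERY finite level `n` and every admissible twist `𝔟`.  A `χ` trivial on `U_n` reads the Artin symbol
`(𝔟, Kℚ_n/K) ∈ Gal(Kℚ_n/K) = ⟨γK⟩ ≅ ℤ/7^n`; a level-free `a ∈ ℕ` with `(𝔟, Kℚ_n/K) = γK^a` for all `n` forces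
`(𝔟, Kℚ_∞/K) = γK^a` in `Gal(Kℚ_∞/K) ≅ ℤ₇`, i.e. the `7`-adic Artin exponent `κ(𝔟) ∈ ℤ₇` would be a natural number.
Reading `Gal(Kℚ_∞/K) ≅ Gal(ℚ_∞/ℚ) ≅ 1 + 7ℤ₇` through the cyclotomic character, `(𝔟, ·) ↦ ⟨N𝔟⟩` and `γK ↦ ⟨c⟩`; `a = 0`
gives `⟨N𝔟⟩ = 1`, `N𝔟 = 1`, excluded by `CM.IsTwist` (`𝔟 ≠ ⊤`); and two admissible twists with coprime norms `N₁, N₂ > 1`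
(split primes `q₁ ≠ q₂ ∤ 42𝔣`, infinitely many) give `⟨N₁⟩^{a₂} = ⟨c⟩^{a₁a₂} = ⟨N₂⟩^{a₁}`, so `N₁^{6a₂} = N₂^{6a₁}` in ℕ
with `a_i ≥ 1` — impossible.  Hence `DualExpValueDatum hγ Φ` is EMPTY for every frame, every kernel theorem binding
`D : DualExpValueDatum hγ Φ` (★ `twoSidedComparisonShape_of_inputs` and its corollaries, `IntegralComparisonOfInputs`,
`PeriodPositionKernel`) is vacuously true as typed, and the registered stub `stub_integralComparisonInputsSeven` (zp v16,
conclusion `∃ D : DualExpValueDatum hγ Φ, …`) is dead as typed.  The Skolemisation mis-typed a LEVEL-WISE congruence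
(`a ≡ κ(𝔟) (mod 7^n)`, always solvable) as a level-free natural number.  The old structure keeps its name and file (ledger
items reference it); THIS file is its successor and the ports of block (R)/(KI)/(PK) over `KatoExpDatum` follow.

## FIELD TABLE `DualExpValueDatum` (KatoExpFrame l.116–166) → `KatoExpDatum` (pen D1009 (1) / D1011 (2))

* `ι₇`, `val` — VERBATIM.
* (e1) `val_T`, (e1′) `val_C`, (e2) `val_piK` — the SAME equations, each now under the finite-level hypothesis
  `(∃ n, ∀ σ ∈ U_n, χ σ = 1) →` on `χ` ((b): nothing constrains `val` at characters of infinite order; block (R) instantiates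
  the three laws only at the level-`(n+1)` characters of its binder (hχ)).
* (eV) `val_euK`; (eZ) `uStar`, `zStar`, `uStar_smul_zStar`, `e`, `α₀`, `α₁`, `α_ne_zero`, `n₀`, `val_zStar`; (psiK)
  `bCoef₀`, `bCoef₁`, `psi_eq` — VERBATIM ((c): audited inhabitable as typed, memo §1/§4).
* (art) RE-TYPED ((a′)): `artExp : Ideal (𝓞 Φ.Kcm) → ℤ_[7]` (the `7`-ADIC Artin exponent `κ(𝔟)`, `(𝔟, Kℚ_∞/K) = γK^{κ(𝔟)}`)
  and `art : ∀ 𝔟, IsTwist 7 Φ.𝔣 𝔟 → ∀ (n m : ℕ), PadicInt.toZModPow n (artExp 𝔟) = m → ∀ χ, (∀ σ ∈ U_n, χ σ = 1) →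
  heckeIdealValue χ 𝔟 = χ(γK)^m` — LEVEL-WISE, for ANY natural lift `m` of `κ(𝔟) mod 7^n` (inhabitable by Artin reciprocity
  on `Kℚ_∞/K` and pro-cyclicity on `γK`; equivalent in content to the `appr`-letter of D1009 (1)(a)).

## Design (pen D1009 (1)–(2)): (T-a) for the DATA, (T-c) for the INTERFACE

Kato 15.14–15.17 READ `x_𝔟 = N𝔟 − ψ(𝔟)σ_𝔟 ∈ Λ_O` explicitly ((C4b): `x_𝔟(0)`, coprimality over varying `𝔟`, unit control),
so `σ_𝔟` is kept EXPLICIT: `D.sigma 𝔟 := PowerSeries.binomialSeries ℤ_[7] (artExp 𝔟) = (1+X)^{κ(𝔟)} ∈ Λ` (Washington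
§13.2 «`γ^x ↦ (1+T)^x`»; tree `IwasawaAlgebraGeneratorChange`), and `D.xTilde 𝔟 = 2N𝔟 − (b₀(𝔟) + b₁(𝔟)π)·σ_𝔟` is the old
`xTilde` with `(1+X)^{a_𝔟} ↦ σ_𝔟`.  Consumers never see the binomial series: the (T-c) interface is the DERIVED eigen-lemma
★ `KatoExpDatum.val_sigma_smul : val χ (σ_𝔟 • y) = χ(𝔟)⁻¹ · val χ y` for `χ` of level `n` (from (e1) at level `n`,
`(χ γK)⁻¹ ^ 7^n = 1`, (art) at a natural lift `m`, and (L) `val_binomialSeries_smul`), which is exactly the `hPval`/`hw` pair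
STEP 1 of ★ feeds to `ev_normForm_eq_zero` (opaque `P`, `w`) with `P := σ_𝔟` LEVEL-FREE as the cyclotomic-divisibility
step requires.

## Contents
§1 the structure `KatoExpDatum hγ Φ` and `KatoExpCompatShape hγ Φ := Nonempty (KatoExpDatum hγ Φ)`; §2 API re-issued over
the new datum (`val_smul_piK`, `val_intCast_smul`; the ★-value non-vanishing in the datum-FREE form
`PinnedKatoGenusFrame.ne_zero_of_valueLaw`) and the (T-c) interface (`sigma`,
`exists_nat_toZModPow_artExp`, `inv_heckeIdealValue_eq_pow`, `val_sigma_smul_eq_pow`, ★ `val_sigma_smul`, `charEval_sigma`);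
§3 the explicit data `xTilde` (with `σ_𝔟`), `cZ`, `normA`, `jα`, `wα` (letter-for-letter otherwise) with
`natCast_toNat_normSeven` (datum-free), `natCast_normA_eq`, `normA_ne_zero`, `isUnit_wα`, `sTwoSided_eq` (the last two re-homed from `RamifiedSevenRationalComparisonOfInputs`, where they were proved
over the dead datum).  No instance, no notation, no axiom, no sorry; debt 0.

HONEST LABEL: a hypothesis structure (re-typed so that it CAN be inhabited), a predicate, definitions with bodies and kernel
lemmas about them; nothing is asserted to exist; no stub is closed; stmt-BirchSwinnertonDyer-19945 is OPEN (stub 2 dead as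
typed until the pen's zp v17 re-points it at `KatoExpDatum`); K2ᶜ-inhabitation is NOT done; `X12.CMRamifiedSeven` is NOT
proved; no summit statement is proved by this seat; BSD is claimed for no curve.

References: K. Kato, Astérisque 295 (2004) Prop. 15.9 / (15.9.1) (pp. 258–259), §15.7 (p. 256), (15.8.1) (p. 257), (15.12.2)
(p. 263), 15.14 (p. 264), (15.16.1) (p. 265), Thm. 12.4 (2) / 12.5 (1) (p. 221), 13.5 (p. 227) [Kato2004Asterisque];
S. Bloch, K. Kato (1990) Def. 3.10, Ex. 3.10.1–3.11 [BlochKato1990]; J. Neukirch, A. Schmidt, K. Wingberg (2008) XI §1–§2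
(ℤ_p-extensions, Artin map) [NeukirchSchmidtWingberg2008]; L. C. Washington (1997) §13.2 [Washington1997]; tree (E) p781874,
(A) p779866/p781372, block (R) p782019, (L) `IwasawaAlgebraCharacterEvaluationCongruence`; pen D1008/D1009/D1011.
-/

noncomputable section

open scoped NumberField TensorProduct
open Field IsDedekindDomain NumberField
open Literature.NumberTheory.GaloisRepresentations
open Literature.NumberTheory.EllipticCurves
open Literature.NumberTheory.EllipticCurves.Rank1Residual
open Literature.NumberTheory.EllipticCurves.IwasawaAlgebra
open Literature.NumberTheory.EllipticCurves.Kato2004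
open Literature.NumberTheory.ComplexMultiplication.EllipticUnits
open Summit.BirchSwinnertonDyer.Rank1Residual

namespace Summit.BirchSwinnertonDyer.Rank1Residual.Additive.GenusSeven

/-- For integers `(α₀, α₁) ≠ 0`: the natural number `(α₀² + 7α₁²).toNat` casts back to `α₀² + 7α₁²` and is non-zero
(the norm form of `ℤ[√−7]` is anisotropic). [cite: Kato2004Asterisque, (15.16.1) (p. 265)] -/
theorem natCast_toNat_normSeven {α₀ α₁ : ℤ} (h : α₀ ≠ 0 ∨ α₁ ≠ 0) :
    (((α₀ ^ 2 + 7 * α₁ ^ 2).toNat : ℕ) : ℤ) = α₀ ^ 2 + 7 * α₁ ^ 2 ∧ (α₀ ^ 2 + 7 * α₁ ^ 2).toNat ≠ 0 := by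
  have hpos : 0 < α₀ ^ 2 + 7 * α₁ ^ 2 := by
    rcases h with h | h
    · have := sq_pos_of_ne_zero h; nlinarith [sq_nonneg α₁]
    · have := sq_pos_of_ne_zero h; nlinarith [sq_nonneg α₀]
  have h1 : (((α₀ ^ 2 + 7 * α₁ ^ 2).toNat : ℕ) : ℤ) = α₀ ^ 2 + 7 * α₁ ^ 2 := Int.toNat_of_nonneg hpos.le
  exact ⟨h1, fun h0 => by rw [h0] at h1; push_cast at h1; omega⟩

section Frame

variable {W : WeierstrassCurve ℚ} [W.IsElliptic] [W.IsGloballyMinimal] [Fact (Nat.Prime 7)]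
  [ContinuousSMul ℤ_[7] (W.tateModule 7)] {K : ZpExtension ℚ 7} {hK : K.IsCyclotomic}
  {γ : Field.absoluteGaloisGroup ℚ} {I : IwasawaH1Data W 7 K γ}
  {F : GenusFrame} {θu : ∀ n : ℕ, globalUnitsOf (F.layer n)} {d : GenusDatum F θu}

/-! ## §1 The re-typed dual-exponential value datum of a pinned frame -/

/-- **`KatoExpDatum hγ Φ` — the `χ`-components of the dual exponential on `𝐇′(S′_W) = Φ.IK.H`, read in ℂ, with Kato's
value laws for the (λ1) classes `euK 𝔟` and for the ★-class; successor of `DualExpValueDatum hγ Φ` with the Artin datum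
RE-TYPED** (module docstring «ERRATUM» / «FIELD TABLE»): data `ι₇`, `val χ`, the `Λˣ`-normalised ★-class `zStar` and its
value constants `(e, α₀, α₁, n₀)`, the integer coordinates `b₀(𝔟), b₁(𝔟)` of `2ψ(𝔟)`, and the `7`-ADIC Artin exponent
`artExp 𝔟 = κ(𝔟) ∈ ℤ₇`; axioms (e1)(e1′)(e2) at characters of FINITE level (naturality / `ℤ₇`-linearity /
CM-functoriality of `exp*`), (eV), (eZ), (psiK) verbatim, and (art) LEVEL-WISE: `χ(𝔟) = χ(γK)^m` for `χ` of level `n` and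
any natural `m ≡ κ(𝔟) (mod 7^n)` (Artin reciprocity on `Kℚ_∞/K`).  A HYPOTHESIS STRUCTURE; nothing is asserted to exist;
no named fact.
[cite: Kato2004Asterisque, Prop. 15.9 (15.9.1) (pp. 258–259), Thm. 12.5 (1) (p. 221), (15.12.2) (p. 263), 15.14 (p. 264), (15.16.1) (p. 265), §15.7 (p. 256)]
[cite: BlochKato1990, Def. 3.10 and Ex. 3.10.1–3.11 (pp. 359–361)] [cite: NeukirchSchmidtWingberg2008, XI §1–§2] -/
structure KatoExpDatum (hγ : K.IsTopGenerator γ) (Φ : PinnedKatoGenusFrame W K hK I d) : Type where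
  /-- A complex reading of `7`-adic coefficients. -/
  ι₇ : ℚ_[7] →+* ℂ
  /-- The `χ`-component of `exp*` on `𝐇′(S′_W)`, read in ℂ, for every continuous character `χ` of `Γ_{Kcm}`. -/
  val : (absoluteGaloisGroup Φ.Kcm →ₜ* ℂˣ) → (Φ.IK.H →+ ℂ)
  /-- (e1) naturality of `exp*`: `γK` acts on the `χ`-component by `χ(γK)⁻¹`, for `χ` of finite level. -/
  val_T : ∀ (χ : absoluteGaloisGroup Φ.Kcm →ₜ* ℂˣ),
    (∃ n : ℕ, ∀ σ ∈ (K.restrictOfFinrankEqTwo (by decide) Φ.Kcm Φ.finrank_Kcm).layerSubgroup n, χ σ = 1) →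
    ∀ (x : Φ.IK.H),
      val χ ((1 + PowerSeries.X : IwasawaAlgebra 7) • x) = (((χ Φ.γK)⁻¹ : ℂˣ) : ℂ) * val χ x
  /-- (e1′) `ℤ₇`-linearity, read through `ι₇`, for `χ` of finite level. -/
  val_C : ∀ (χ : absoluteGaloisGroup Φ.Kcm →ₜ* ℂˣ),
    (∃ n : ℕ, ∀ σ ∈ (K.restrictOfFinrankEqTwo (by decide) Φ.Kcm Φ.finrank_Kcm).layerSubgroup n, χ σ = 1) →
    ∀ (c : ℤ_[7]) (x : Φ.IK.H),
      val χ ((PowerSeries.C c : IwasawaAlgebra 7) • x) = ι₇ (c : ℚ_[7]) * val χ x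
  /-- (e2) CM-functoriality: the CM operator `piK` (`= (T₇φ)_*`) acts on values by `ιC(√−7)`, for `χ` of finite level. -/
  val_piK : ∀ (χ : absoluteGaloisGroup Φ.Kcm →ₜ* ℂˣ),
    (∃ n : ℕ, ∀ σ ∈ (K.restrictOfFinrankEqTwo (by decide) Φ.Kcm Φ.finrank_Kcm).layerSubgroup n, χ σ = 1) →
    ∀ (x : Φ.IK.H),
      val χ (Φ.piK x) = Φ.ιC (algebraMap Φ.Kcm (AlgebraicClosure Φ.Kcm) Φ.sqrtNegSeven) * val χ x
  /-- (eV) the values of the elliptic-unit classes: (15.9.1) on the cyclotomic layer `Kℚ_n` (= the frame's (Z4)(Z5)). -/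
  val_euK : ∀ (𝔟 : Ideal (𝓞 Φ.Kcm)), IsTwist 7 Φ.𝔣 𝔟 → ∀ (n : ℕ) (χ : absoluteGaloisGroup Φ.Kcm →ₜ* ℂˣ),
    (∀ σ ∈ (K.restrictOfFinrankEqTwo (by decide) Φ.Kcm Φ.finrank_Kcm).layerSubgroup n, χ σ = 1) →
    ∀ Lf : ℂ → ℂ, CM.IsDepletedHeckeL Φ.ψ χ (7 * (7 * F.d)) Lf →
      val χ (Φ.euK 𝔟) =
        (((Ideal.absNorm 𝔟 : ℕ) : ℂ) - CM.heckeCharIdealValue Φ.ψ 𝔟 * (heckeIdealValue χ 𝔟)⁻¹) * Φ.Ω⁻¹ * Lf 1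
  /-- (eZ) the ★-unit and the `Λˣ`-normalised ★-class `zStar` (`uStar • zStar = res zOne`) … -/
  uStar : (IwasawaAlgebra 7)ˣ
  zStar : Φ.IK.H
  uStar_smul_zStar : ((uStar : IwasawaAlgebra 7)) • zStar = I.resOver Φ.IK hγ Φ.isTopGenerator_γK Φ.zOne
  /-- … its value constants: a `7`-power `7^e`, `α = α₀ + α₁√−7 ∈ K^×`, a threshold `n₀` … -/
  e : ℕ
  α₀ : ℤ
  α₁ : ℤ
  α_ne_zero : α₀ ≠ 0 ∨ α₁ ≠ 0
  n₀ : ℕ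
  /-- … and its value law at characters of PRIMITIVE level `n + 1`, `n ≥ n₀`. -/
  val_zStar : ∀ (n : ℕ), n₀ ≤ n → ∀ (χ : absoluteGaloisGroup Φ.Kcm →ₜ* ℂˣ),
    (∀ σ ∈ (K.restrictOfFinrankEqTwo (by decide) Φ.Kcm Φ.finrank_Kcm).layerSubgroup (n + 1), χ σ = 1) →
    IsPrimitiveRoot (((χ Φ.γK : ℂˣ)) : ℂ) (7 ^ (n + 1)) →
    ∀ Lf : ℂ → ℂ, CM.IsDepletedHeckeL Φ.ψ χ (7 * (7 * F.d)) Lf →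
      (7 : ℂ) ^ e * val χ zStar =
        ((α₀ : ℂ) + (α₁ : ℂ) * Φ.ιC (algebraMap Φ.Kcm (AlgebraicClosure Φ.Kcm) Φ.sqrtNegSeven)) * Φ.Ω⁻¹ * Lf 1
  /-- (psiK) `ψ(𝔟) ∈ O_K = ℤ[(1+√−7)/2]`: the integer coordinates `2ψ(𝔟) = b₀(𝔟) + b₁(𝔟)√−7` (Skolemised). -/
  bCoef₀ : Ideal (𝓞 Φ.Kcm) → ℤ
  bCoef₁ : Ideal (𝓞 Φ.Kcm) → ℤ
  psi_eq : ∀ (𝔟 : Ideal (𝓞 Φ.Kcm)), IsTwist 7 Φ.𝔣 𝔟 →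
    2 * CM.heckeCharIdealValue Φ.ψ 𝔟 =
      (bCoef₀ 𝔟 : ℂ) + (bCoef₁ 𝔟 : ℂ) * Φ.ιC (algebraMap Φ.Kcm (AlgebraicClosure Φ.Kcm) Φ.sqrtNegSeven)
  /-- (art) RE-TYPED: the `7`-ADIC Artin exponent `κ(𝔟) ∈ ℤ₇` of an admissible twist, `(𝔟, Kℚ_∞/K) = γK^{κ(𝔟)}`
  (Skolemised) … -/
  artExp : Ideal (𝓞 Φ.Kcm) → ℤ_[7]
  /-- … and Artin reciprocity LEVEL-WISE: `χ(𝔟) = χ(γK)^m` for every `χ` trivial on `U_n` and every natural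
  `m ≡ κ(𝔟) (mod 7^n)`. -/
  art : ∀ (𝔟 : Ideal (𝓞 Φ.Kcm)), IsTwist 7 Φ.𝔣 𝔟 → ∀ (n m : ℕ),
    PadicInt.toZModPow n (artExp 𝔟) = (m : ZMod (7 ^ n)) →
    ∀ (χ : absoluteGaloisGroup Φ.Kcm →ₜ* ℂˣ),
      (∀ σ ∈ (K.restrictOfFinrankEqTwo (by decide) Φ.Kcm Φ.finrank_Kcm).layerSubgroup n, χ σ = 1) →
        heckeIdealValue χ 𝔟 = (((χ Φ.γK : ℂˣ)) : ℂ) ^ m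

/-- **`KatoExpCompatShape hγ Φ`** :≡ the pinned frame `Φ` ADMITS a (re-typed) dual-exponential value datum — the (r3)
binder of block (R) over `KatoExpDatum` (successor of `DualExpCompatShape`, which is `Nonempty` of the EMPTY old datum).
A predicate; nothing asserted. [cite: Kato2004Asterisque, Prop. 15.9 (p. 258), Thm. 12.5 (1) (p. 221), (15.16.1) (p. 265)]
[cite: BlochKato1990, Def. 3.10 (p. 359)] -/
def KatoExpCompatShape (hγ : K.IsTopGenerator γ) (Φ : PinnedKatoGenusFrame W K hK I d) : Prop :=
  Nonempty (KatoExpDatum hγ Φ)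

/-- Unfolding `KatoExpCompatShape`. [cite: Kato2004Asterisque, (15.16.1) (p. 265)] -/
theorem katoExpCompatShape_iff (hγ : K.IsTopGenerator γ) (Φ : PinnedKatoGenusFrame W K hK I d) :
    KatoExpCompatShape hγ Φ ↔ Nonempty (KatoExpDatum hγ Φ) :=
  Iff.rfl

/-! ## §2 API over the re-typed datum, and the DERIVED (T-c) interface `σ_𝔟 ∈ Λ` -/

namespace PinnedKatoGenusFrame

/-- A value `V` subject to a ★-type value law `7^e·V = (α₀ + α₁·ιC(√−7))·Ω⁻¹·L` with integers `(α₀, α₁) ≠ 0` and `L ≠ 0`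
is NON-ZERO (`α₀ + α₁√−7 ≠ 0`, `Ω ≠ 0`) — datum-free form of «the values of the ★-class are non-zero where
`L_{7f}(ψ̄, χ, 1) ≠ 0`», fed with (eZ) `D.val_zStar` by block (R). [cite: Kato2004Asterisque, Thm. 12.5 (2) (p. 221) and 13.5 (p. 227)] -/
theorem ne_zero_of_valueLaw (Φ : PinnedKatoGenusFrame W K hK I d) {α₀ α₁ : ℤ} (hα : α₀ ≠ 0 ∨ α₁ ≠ 0) {e : ℕ}
    {V L : ℂ} (h : (7 : ℂ) ^ e * V = ((α₀ : ℂ) + (α₁ : ℂ) * Φ.ιC (algebraMap Φ.Kcm (AlgebraicClosure Φ.Kcm) Φ.sqrtNegSeven)) *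
      Φ.Ω⁻¹ * L) (hL : L ≠ 0) : V ≠ 0 := by
  intro h0
  rw [h0, mul_zero] at h
  exact mul_ne_zero (mul_ne_zero (Φ.intCast_add_mul_sqrt_ne_zero hα) (inv_ne_zero Φ.Ω_ne_zero)) hL h.symm

end PinnedKatoGenusFrame

namespace KatoExpDatum

variable {hγ : K.IsTopGenerator γ} {Φ : PinnedKatoGenusFrame W K hK I d} (D : KatoExpDatum hγ Φ)

/-- `val χ (f • piK y) = ιC(√−7)·val χ (f • y)` (χ of finite level). [cite: Kato2004Asterisque, §15.3 (p. 252) and 15.14 (p. 264)] -/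
theorem val_smul_piK (χ : absoluteGaloisGroup Φ.Kcm →ₜ* ℂˣ)
    (hχ : ∃ n : ℕ, ∀ σ ∈ (K.restrictOfFinrankEqTwo (by decide) Φ.Kcm Φ.finrank_Kcm).layerSubgroup n, χ σ = 1)
    (f : IwasawaAlgebra 7) (y : Φ.IK.H) :
    D.val χ (f • Φ.piK y) = Φ.ιC (algebraMap Φ.Kcm (AlgebraicClosure Φ.Kcm) Φ.sqrtNegSeven) * D.val χ (f • y) := by
  rw [← Φ.piK_smul, D.val_piK χ hχ]

/-- Integer scalars pass through `val`: `val χ ((c : Λ) • x) = c·val χ x` (`ι₇` is the identity on ℤ; χ of finite level).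
[cite: Kato2004Asterisque, Thm. 12.5 (1) (p. 221)] -/
theorem val_intCast_smul (χ : absoluteGaloisGroup Φ.Kcm →ₜ* ℂˣ)
    (hχ : ∃ n : ℕ, ∀ σ ∈ (K.restrictOfFinrankEqTwo (by decide) Φ.Kcm Φ.finrank_Kcm).layerSubgroup n, χ σ = 1)
    (c : ℤ) (x : Φ.IK.H) :
    D.val χ ((c : IwasawaAlgebra 7) • x) = (c : ℂ) * D.val χ x := by
  have h : ((c : IwasawaAlgebra 7)) = PowerSeries.C ((c : ℤ_[7])) := by
    rw [map_intCast]
  rw [h, D.val_C χ hχ, PadicInt.coe_intCast, map_intCast]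

/-- **`D.sigma 𝔟 = σ_𝔟 := (1+X)^{κ(𝔟)} ∈ Λ`** — the image in `Λ = ℤ₇⟦X⟧` (`γK ↦ 1 + X`) of the Artin symbol
`(𝔟, Kℚ_∞/K) = γK^{κ(𝔟)}`: the binomial power series with the `7`-adic exponent `κ(𝔟) = D.artExp 𝔟`.
[cite: Washington1997, §13.2] [cite: Kato2004Asterisque, (15.12.2) (p. 263)] -/
def sigma (𝔟 : Ideal (𝓞 Φ.Kcm)) : IwasawaAlgebra 7 :=
  PowerSeries.binomialSeries ℤ_[7] (D.artExp 𝔟)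

/-- Unfolding `sigma`. [cite: Washington1997, §13.2] -/
theorem sigma_def (𝔟 : Ideal (𝓞 Φ.Kcm)) : D.sigma 𝔟 = PowerSeries.binomialSeries ℤ_[7] (D.artExp 𝔟) := rfl

/-- Every level `n` has a natural lift `m ≡ κ(𝔟) (mod 7^n)`. [cite: NeukirchSchmidtWingberg2008, XI §1] -/
theorem exists_nat_toZModPow_artExp (𝔟 : Ideal (𝓞 Φ.Kcm)) (n : ℕ) :
    ∃ m : ℕ, PadicInt.toZModPow n (D.artExp 𝔟) = (m : ZMod (7 ^ n)) := by
  haveI : NeZero (7 ^ n) := ⟨pow_ne_zero n (by norm_num)⟩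
  exact ⟨(PadicInt.toZModPow n (D.artExp 𝔟)).val, (ZMod.natCast_zmod_val _).symm⟩

/-- (art) inverted: `χ(𝔟)⁻¹ = (χ(γK)⁻¹)^m` for `χ` of level `n` and a natural lift `m ≡ κ(𝔟) (mod 7^n)`.
[cite: NeukirchSchmidtWingberg2008, XI §2 (Artin map of a ℤ_p-extension)] -/
theorem inv_heckeIdealValue_eq_pow (χ : absoluteGaloisGroup Φ.Kcm →ₜ* ℂˣ) {n : ℕ}
    (hχ : ∀ σ ∈ (K.restrictOfFinrankEqTwo (by decide) Φ.Kcm Φ.finrank_Kcm).layerSubgroup n, χ σ = 1)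
    {𝔟 : Ideal (𝓞 Φ.Kcm)} (h𝔟 : IsTwist 7 Φ.𝔣 𝔟) {m : ℕ}
    (hm : PadicInt.toZModPow n (D.artExp 𝔟) = (m : ZMod (7 ^ n))) :
    (heckeIdealValue χ 𝔟)⁻¹ = ((((χ Φ.γK)⁻¹ : ℂˣ)) : ℂ) ^ m := by
  rw [D.art 𝔟 h𝔟 n m hm χ hχ, Units.val_inv_eq_inv_val, inv_pow]

/-- `σ_𝔟` acts on the values at a level-`n` character by `(χ(γK)⁻¹)^m`, `m` any natural lift of `κ(𝔟) mod 7^n`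
((e1) + `(χ γK)⁻¹ ^ 7^n = 1` + `(1+X)^{κ} ≡ (1+X)^m (mod ω_n)`). [cite: Washington1997, §13.2]
[cite: Kato2004Asterisque, Thm. 12.5 (1) (p. 221)] -/
theorem val_sigma_smul_eq_pow (χ : absoluteGaloisGroup Φ.Kcm →ₜ* ℂˣ) {n : ℕ}
    (hχ : ∀ σ ∈ (K.restrictOfFinrankEqTwo (by decide) Φ.Kcm Φ.finrank_Kcm).layerSubgroup n, χ σ = 1)
    (𝔟 : Ideal (𝓞 Φ.Kcm)) {m : ℕ} (hm : PadicInt.toZModPow n (D.artExp 𝔟) = (m : ZMod (7 ^ n))) (y : Φ.IK.H) :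
    D.val χ (D.sigma 𝔟 • y) = ((((χ Φ.γK)⁻¹ : ℂˣ)) : ℂ) ^ m * D.val χ y :=
  val_binomialSeries_smul (D.val_T χ ⟨n, hχ⟩) (Φ.inv_chi_γK_pow_eq_one χ hχ) hm y

/-- ★ **THE EIGEN-LEMMA (the (T-c) interface of block (R))**: `val χ (σ_𝔟 • y) = χ(𝔟)⁻¹ · val χ y` for every `χ` of
finite level `n` and every admissible `𝔟` — the old Skolemised field `art` turned into a THEOREM (from (e1), (art) at a
natural lift, and the `ω_n`-congruence of `p`-adic powers).  This is the pair (`hPval`, `hw`) that STEP 1 of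
★ `twoSidedComparisonShape_of_inputs` feeds to `ev_normForm_eq_zero` with `P := σ_𝔟` level-free.
[cite: Kato2004Asterisque, (15.12.2) (p. 263) and Thm. 12.5 (1) (p. 221)] [cite: Washington1997, §13.2] -/
theorem val_sigma_smul (χ : absoluteGaloisGroup Φ.Kcm →ₜ* ℂˣ) {n : ℕ}
    (hχ : ∀ σ ∈ (K.restrictOfFinrankEqTwo (by decide) Φ.Kcm Φ.finrank_Kcm).layerSubgroup n, χ σ = 1)
    {𝔟 : Ideal (𝓞 Φ.Kcm)} (h𝔟 : IsTwist 7 Φ.𝔣 𝔟) (y : Φ.IK.H) :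
    D.val χ (D.sigma 𝔟 • y) = (heckeIdealValue χ 𝔟)⁻¹ * D.val χ y := by
  obtain ⟨m, hm⟩ := D.exists_nat_toZModPow_artExp 𝔟 n
  rw [D.val_sigma_smul_eq_pow χ hχ 𝔟 hm, D.inv_heckeIdealValue_eq_pow χ hχ h𝔟 hm]

/-- `charEval` of `σ_𝔟` at level `n`: `charEval 7 ι u n (σ_𝔟) = u^m` for `u^{7^n} = 1` and a natural lift `m` of
`κ(𝔟) mod 7^n` (so `= χ(𝔟)⁻¹` at `u = χ(γK)⁻¹` by (art)). [cite: Washington1997, §13.2 and §7.1 Prop. 7.2] -/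
theorem charEval_sigma {B : Type*} [CommRing B] (ι : ℤ_[7] →+* B) {u : B} {n : ℕ} (hu : u ^ 7 ^ n = 1)
    (𝔟 : Ideal (𝓞 Φ.Kcm)) {m : ℕ} (hm : PadicInt.toZModPow n (D.artExp 𝔟) = (m : ZMod (7 ^ n))) :
    charEval 7 ι u n (D.sigma 𝔟) = u ^ m :=
  charEval_binomialSeries 7 ι hu hm

/-! ## §3 The EXPLICIT data of block (R) over the re-typed datum (letter-for-letter except `(1+X)^{a_𝔟} ↦ σ_𝔟`) -/

/-- **`D.xTilde 𝔟 ∈ Λ_O`** — the explicit element `2N𝔟 − (b₀(𝔟) + b₁(𝔟)·π)·σ_𝔟` (`π ↔ √−7`, `σ_𝔟 = (1+X)^{κ(𝔟)}`):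
TWICE Kato's `x_𝔟 = «N𝔟 − ψ(𝔟)σ_𝔟»` read in `Λ_O` (its `χ`-component value is `2(N𝔟 − ψ(𝔟)χ(𝔟)⁻¹)`,
(15.9.1)/(15.12.2)); it stands in for the unpinned `Φ.frame.x 𝔟` in the exact-constant shapes.
[cite: Kato2004Asterisque, (15.12.2) (p. 263) and 15.14 (p. 264)] -/
def xTilde (𝔟 : Ideal (𝓞 Φ.Kcm)) : Φ.R :=
  algebraMap (IwasawaAlgebra 7) Φ.R
      ((((2 * Ideal.absNorm 𝔟 : ℕ) : ℤ) : IwasawaAlgebra 7) - (D.bCoef₀ 𝔟 : IwasawaAlgebra 7) * D.sigma 𝔟) -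
    algebraMap (IwasawaAlgebra 7) Φ.R (D.bCoef₁ 𝔟 : IwasawaAlgebra 7) *
      algebraMap (IwasawaAlgebra 7) Φ.R (D.sigma 𝔟) * Φ.π

/-- Unfolding `xTilde`. [cite: Kato2004Asterisque, (15.12.2) (p. 263)] -/
theorem xTilde_def (𝔟 : Ideal (𝓞 Φ.Kcm)) :
    D.xTilde 𝔟 =
      algebraMap (IwasawaAlgebra 7) Φ.R
          ((((2 * Ideal.absNorm 𝔟 : ℕ) : ℤ) : IwasawaAlgebra 7) - (D.bCoef₀ 𝔟 : IwasawaAlgebra 7) * D.sigma 𝔟) -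
        algebraMap (IwasawaAlgebra 7) Φ.R (D.bCoef₁ 𝔟 : IwasawaAlgebra 7) *
          algebraMap (IwasawaAlgebra 7) Φ.R (D.sigma 𝔟) * Φ.π :=
  rfl

/-- **`D.cZ ∈ Λ_O`** — the explicit right constant `(α₀ − α₁π)·7^e · uStar⁻¹·7^k·u·π^a` of block (R) (verbatim).
[cite: Kato2004Asterisque, (15.16.1) (p. 265) and Thm. 12.5 (1) (p. 221)] -/
def cZ : Φ.R :=
  ((algebraMap (IwasawaAlgebra 7) Φ.R (D.α₀ : IwasawaAlgebra 7) -
        algebraMap (IwasawaAlgebra 7) Φ.R (D.α₁ : IwasawaAlgebra 7) * Φ.π) *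
      algebraMap (IwasawaAlgebra 7) Φ.R ((7 ^ D.e : ℤ) : IwasawaAlgebra 7)) *
    (algebraMap (IwasawaAlgebra 7) Φ.R (↑(D.uStar⁻¹) : IwasawaAlgebra 7) *
      (algebraMap (IwasawaAlgebra 7) Φ.R ((7 : IwasawaAlgebra 7) ^ Φ.k) * ((Φ.u : Φ.R) * Φ.π ^ Φ.a)))

/-- `N(α) = α₀² + 7α₁²` as a natural number (verbatim). [cite: Kato2004Asterisque, (15.16.1) (p. 265)] -/
def normA : ℕ := (D.α₀ ^ 2 + 7 * D.α₁ ^ 2).toNat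

/-- `jα = v₇(N(α))` (verbatim). [cite: Kato2004Asterisque, (15.16.1) (p. 265)] -/
def jα : ℕ := D.normA.factorization 7

/-- `(normA : ℤ) = α₀² + 7α₁²`. [cite: Kato2004Asterisque, (15.16.1) (p. 265)] -/
theorem natCast_normA_eq : (D.normA : ℤ) = D.α₀ ^ 2 + 7 * D.α₁ ^ 2 :=
  (natCast_toNat_normSeven D.α_ne_zero).1

/-- `normA ≠ 0`. [cite: Kato2004Asterisque, (15.16.1) (p. 265)] -/
theorem normA_ne_zero : D.normA ≠ 0 :=
  (natCast_toNat_normSeven D.α_ne_zero).2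

/-- **`D.wα ∈ Λ_O`** — the explicit left unit `v^{jα}·(2·N(α)/7^{jα})` of block (R) (verbatim).
[cite: Kato2004Asterisque, (15.16.1) (p. 265)] -/
def wα : Φ.R :=
  (Φ.v : Φ.R) ^ D.jα * algebraMap (IwasawaAlgebra 7) Φ.R ((2 * (D.normA / 7 ^ D.jα) : ℕ) : IwasawaAlgebra 7)

/-- `wα` is a unit of `Λ_O` (`7 ∤ 2·N(α)/7^{jα}`, `Λ` local with residue field `𝔽₇`); re-homed from block (R).
[cite: Washington1997, §7.1] -/
theorem isUnit_wα : IsUnit D.wα := by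
  obtain ⟨hu, -⟩ := two_mul_natCast_eq_unit_mul_pow (N := D.normA) D.normA_ne_zero
  exact (Φ.v.isUnit.pow D.jα).mul (hu.map (algebraMap (IwasawaAlgebra 7) Φ.R))

/-- The left constant of ★ is `wα·π^{m₀ + 2jα}` (`2N(α) = (2N(α)/7^{jα})·7^{jα}`, `7 = v·π²`); re-homed from block (R).
[cite: Kato2004Asterisque, (15.16.1) (p. 265)] -/
theorem sTwoSided_eq (m₀ : ℕ) :
    Φ.π ^ m₀ * algebraMap (IwasawaAlgebra 7) Φ.R (((2 * (D.α₀ ^ 2 + 7 * D.α₁ ^ 2) : ℤ) : IwasawaAlgebra 7)) =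
      D.wα * Φ.π ^ (m₀ + 2 * D.jα) := by
  have heq : ((2 * D.normA : ℕ) : IwasawaAlgebra 7) =
      ((2 * (D.normA / 7 ^ D.jα) : ℕ) : IwasawaAlgebra 7) * (7 : IwasawaAlgebra 7) ^ D.jα :=
    (two_mul_natCast_eq_unit_mul_pow (N := D.normA) D.normA_ne_zero).2
  have hcast : (((2 * (D.α₀ ^ 2 + 7 * D.α₁ ^ 2) : ℤ) : IwasawaAlgebra 7)) = ((2 * D.normA : ℕ) : IwasawaAlgebra 7) := by
    rw [← D.natCast_normA_eq]; push_cast; ring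
  have h7 : algebraMap (IwasawaAlgebra 7) Φ.R 7 = (Φ.v : Φ.R) * Φ.π ^ 2 := by
    rw [map_ofNat]; exact Φ.seven_eq
  rw [hcast, heq, map_mul, map_pow, h7, KatoExpDatum.wα, pow_add, pow_mul, mul_pow]
  ring

end KatoExpDatum

end Frame

end Summit.BirchSwinnertonDyer.Rank1Residual.Additive.GenusSeven

end
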